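import Summits.NavierStokesRegularity.NavierStokesRegularity.Theorems.TypeIIInviscidRelaxationAxisymSwirlRegularZhangBarrierW
import Summits.NavierStokesRegularity.NavierStokesRegularity.Theorems.HodographBetchovFastClassSqueezeOfBounded
import Literature.Analysis.FluidPDE.AxisymmetricMixedEnvelopeRegularity
import Literature.Analysis.FluidPDE.KNSSNoAxisymmetricTypeIHolds
import Literature.Analysis.FluidPDE.PeriodicCylinderNeumannWeakTangential
import HarnessLib

/-!
# The Chen–Strain–Tsai–Yau 2009 mixed-envelope theorem — Literature named fact
# `ChenStrainTsaiYau2009_mixedEnvelope_regular` DISCHARGED from the tree's one-sided κ-inflow criterion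

Helper toward the crux `AxisymSwirlRegular` (stmt-NavierStokesRegularity-1964, route
`TypeIIInviscidRelaxation`; theorems only, no definitions).  Chen–Strain–Tsai–Yau, *Lower bounds on the
blow-up rate of the axisymmetric Navier–Stokes equations II*, CPDE 34 (2009), Thm 1.1 (arXiv:0709.4230
§1, (1.4)): an axisymmetric solution with `|v(x,t)| ≤ C_* r^{-1+ε}|t|^{-ε/2}` for some `ε ∈ [0,1]`, `C_*`
arbitrary, is regular.  The tree carries it as the unproved named fact
`Literature.Analysis.FluidPDE.ChenStrainTsaiYau2009_mixedEnvelope_regular` (forward clock, classical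
Leray–Hopf solutions from rapidly decaying data, envelope `HasMixedEnvelope ε C T u` on `(0,T) × ℝ³`,
conclusion: bounded on `[0,T) × B_R` for every `R`).  It is now a TREE THEOREM:

* `0 < ε ≤ 1`: the TWO-SIDED envelope trivially gives the ONE-SIDED κ-gate of the radial velocity on the
  unit tube, `u_r ≥ -‖u‖ ≥ -M r^{ε-1}(T-t)^{-ε/2}` (`norm_le_of_mixedEnvelope`,
  `kappaGate_of_mixedEnvelope`; near `t = 0` the sub-slab bound `exists_bound_subslab` is used instead,
  since the envelope is typed on the open interval), and the UNCONDITIONAL κ-inflow criterion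
  `hasSmoothExtensionPast_of_kappaEnvelope_holds` (explicit half-line barrier, `…ZhangBarrierW`)
  continues the solution past `T`;
* `ε = 0`: the axis bound `r|u| ≤ C` is the second alternative of the tree theorem
  `knss_no_axisymmetric_typeI_holds` (KNSS 2009 Thm 6.2; at `t = 0` the bound comes from the rapid
  decay of the datum);
* boundedness on `[0,T) × ℝ³` from the extension: `FastClassSqueeze.bounded_of_hasSmoothExtensionPast`.

So the printed two-sided mixed criteria are COROLLARIES of the tree's one-sided family (the hypotheses
`‖swirl (u 0)‖_∞ < ∞` and `p ∈ L^{5/3}` of the printed statement are not used).  Net Literature debt −1.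
Nothing here bears on the crux ⟨1964⟩ or on Navier–Stokes regularity: a criterion, S-necessary by vacuity.
References: [ChenStrainTsaiYau2009] arXiv:0709.4230 Thm 1.1; [KochNadirashviliSereginSverak2009] Thm 6.2;
[Zhang2026PartialTypeI] arXiv:2604.07785 Thm 1.1 (the `ε = 1` one-sided case).
-/

noncomputable section

open Set Filter Topology Real
open Literature.Analysis.FluidPDE

namespace Summit.NavierStokesRegularity.NavierStokesRegularity.Theorems

set_option linter.dupNamespace false

namespace MixedEnvelopeDischarge

/-- **Pointwise size under the mixed envelope, off the axis.**  If `r^{1-ε}(T-t)^{ε/2}‖u(t,x)‖ ≤ C` with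
`r = cylRadius x > 0` and `t < T`, then `‖u(t,x)‖ ≤ max C 0 · r^{ε-1} · (T-t)^{-ε/2}`.
[cite: ChenStrainTsaiYau2009, Thm. 1.1 (1.4)] -/
theorem norm_le_of_mixedEnvelope {ε C T t : ℝ} {x : EuclideanSpace ℝ (Fin 3)}
    {u : ℝ → EuclideanSpace ℝ (Fin 3) → EuclideanSpace ℝ (Fin 3)}
    (h : cylRadius x ^ (1 - ε) * (T - t) ^ (ε / 2) * ‖u t x‖ ≤ C)
    (hx : 0 < cylRadius x) (ht : t < T) :
    ‖u t x‖ ≤ max C 0 * cylRadius x ^ (ε - 1) * (T - t) ^ (-(ε / 2)) := by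
  have hs : 0 < T - t := sub_pos.2 ht
  have ha : 0 < cylRadius x ^ (1 - ε) := rpow_pos_of_pos hx _
  have hb : 0 < (T - t) ^ (ε / 2) := rpow_pos_of_pos hs _
  have hab : 0 < cylRadius x ^ (1 - ε) * (T - t) ^ (ε / 2) := mul_pos ha hb
  have e1 : cylRadius x ^ (ε - 1) = (cylRadius x ^ (1 - ε))⁻¹ := by
    rw [show ε - 1 = -(1 - ε) by ring, rpow_neg hx.le]
  have e2 : (T - t) ^ (-(ε / 2)) = ((T - t) ^ (ε / 2))⁻¹ := rpow_neg hs.le _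
  rw [e1, e2, mul_assoc, ← mul_inv, ← div_eq_mul_inv, le_div_iff₀ hab]
  calc ‖u t x‖ * (cylRadius x ^ (1 - ε) * (T - t) ^ (ε / 2))
        = cylRadius x ^ (1 - ε) * (T - t) ^ (ε / 2) * ‖u t x‖ := by ring
    _ ≤ C := h
    _ ≤ max C 0 := le_max_left _ _

/-- **The two-sided mixed envelope gives the one-sided κ-gate on the unit tube** (`κ = ε ∈ (0,1]`, `ν = 1`):
from `HasMixedEnvelope ε C T u` on `(0,T)` and a bound `‖u‖ ≤ B` on a closed initial slab `[0,T₁]`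
(`0 < T₁`), for every `t ∈ [0,T)` and `0 < r ≤ 1`,
`u_r(t,x) ≥ -(M · 1^{1-ε/2} · r^{ε-1} · (T-t)^{-ε/2})` with `M = max (max C 0) (max B 0 · T^{ε/2}) + 1 > 0`.
[cite: ChenStrainTsaiYau2009, Thm. 1.1 (1.4)] -/
theorem kappaGate_of_mixedEnvelope {ε C T T₁ B : ℝ} (hε0 : 0 < ε) (hε1 : ε ≤ 1) (hT : 0 < T)
    {u : ℝ → EuclideanSpace ℝ (Fin 3) → EuclideanSpace ℝ (Fin 3)}
    (henv : HasMixedEnvelope ε C T u) (hT₁ : 0 < T₁)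
    (hB : ∀ t ∈ Icc 0 T₁, ∀ x, ‖u t x‖ ≤ B) :
    ∃ M : ℝ, 0 < M ∧ ∀ t ∈ Ico 0 T, ∀ x : EuclideanSpace ℝ (Fin 3), 0 < cylRadius x → cylRadius x ≤ 1 →
      -(M * (1 : ℝ) ^ (1 - ε / 2) * cylRadius x ^ (ε - 1) * (T - t) ^ (-(ε / 2))) ≤
        radialVelocity (u t) x := by
  set M₀ : ℝ := max (max C 0) (max B 0 * T ^ (ε / 2)) with hM₀
  have hM₀0 : 0 ≤ M₀ := (le_max_right C 0).trans (le_max_left _ _)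
  refine ⟨M₀ + 1, by linarith, fun t ht x hx hx1 => ?_⟩
  have hs : 0 < T - t := by linarith [ht.2]
  have hρ : 0 < cylRadius x ^ (ε - 1) := rpow_pos_of_pos hx _
  have hσ : 0 < (T - t) ^ (-(ε / 2)) := rpow_pos_of_pos hs _
  have hρσ : 0 < cylRadius x ^ (ε - 1) * (T - t) ^ (-(ε / 2)) := mul_pos hρ hσ
  -- the pointwise size bound `‖u t x‖ ≤ M₀ r^{ε-1} (T-t)^{-ε/2}` in both regimes
  have hsize : ‖u t x‖ ≤ M₀ * cylRadius x ^ (ε - 1) * (T - t) ^ (-(ε / 2)) := by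
    rcases le_or_gt t T₁ with hle | hlt
    · -- initial slab: `‖u‖ ≤ B ≤ max B 0 · T^{ε/2} · r^{ε-1} (T-t)^{-ε/2}`
      have h1 : ‖u t x‖ ≤ max B 0 := (hB t ⟨ht.1, hle⟩ x).trans (le_max_left _ _)
      have hr : 1 ≤ cylRadius x ^ (ε - 1) := one_le_rpow_of_pos_of_le_one_of_nonpos hx hx1 (by linarith)
      have hst : T ^ (-(ε / 2)) ≤ (T - t) ^ (-(ε / 2)) :=
        rpow_le_rpow_of_nonpos hs (by linarith [ht.1]) (by linarith [hε0.le])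
      have hTk : 0 < T ^ (ε / 2) := rpow_pos_of_pos hT _
      have hTT : T ^ (ε / 2) * T ^ (-(ε / 2)) = 1 := by
        rw [rpow_neg hT.le, mul_inv_cancel₀ hTk.ne']
      have hT0 : 0 ≤ T ^ (-(ε / 2)) := rpow_nonneg hT.le _
      have h2 : max B 0 ≤ max B 0 * T ^ (ε / 2) * cylRadius x ^ (ε - 1) * (T - t) ^ (-(ε / 2)) :=
        calc max B 0 = max B 0 * T ^ (ε / 2) * 1 * T ^ (-(ε / 2)) := by
              rw [mul_one, mul_assoc, hTT, mul_one]
          _ ≤ max B 0 * T ^ (ε / 2) * cylRadius x ^ (ε - 1) * (T - t) ^ (-(ε / 2)) := by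
              apply mul_le_mul _ hst hT0 (by positivity)
              exact mul_le_mul_of_nonneg_left hr (by positivity)
      have h3 : max B 0 * T ^ (ε / 2) * cylRadius x ^ (ε - 1) * (T - t) ^ (-(ε / 2))
          ≤ M₀ * cylRadius x ^ (ε - 1) * (T - t) ^ (-(ε / 2)) := by
        rw [mul_assoc (max B 0 * T ^ (ε / 2)), mul_assoc M₀]
        exact mul_le_mul_of_nonneg_right (le_max_right _ _) hρσ.le
      linarith
    · -- late times `T₁ < t < T`: the envelope itself
      have h1 := norm_le_of_mixedEnvelope (henv t ⟨lt_trans hT₁ hlt, ht.2⟩ x) hx ht.2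
      have h3 : max C 0 * cylRadius x ^ (ε - 1) * (T - t) ^ (-(ε / 2))
          ≤ M₀ * cylRadius x ^ (ε - 1) * (T - t) ^ (-(ε / 2)) := by
        rw [mul_assoc (max C 0), mul_assoc M₀]
        exact mul_le_mul_of_nonneg_right (le_max_left _ _) hρσ.le
      linarith
  have h4 : M₀ * cylRadius x ^ (ε - 1) * (T - t) ^ (-(ε / 2))
      ≤ (M₀ + 1) * (1 : ℝ) ^ (1 - ε / 2) * cylRadius x ^ (ε - 1) * (T - t) ^ (-(ε / 2)) := by
    rw [one_rpow, mul_one, mul_assoc M₀, mul_assoc (M₀ + 1)]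
    exact mul_le_mul_of_nonneg_right (by linarith) hρσ.le
  linarith [neg_norm_le_radialVelocity (u t) x]

end MixedEnvelopeDischarge

open MixedEnvelopeDischarge

/-- **Chen–Strain–Tsai–Yau 2009 Thm 1.1 — the Literature named fact
`ChenStrainTsaiYau2009_mixedEnvelope_regular` DISCHARGED.**  An axisymmetric classical Leray–Hopf solution on
`[0,T)` (`ν = 1`) from a rapidly decaying datum obeying the mixed envelope `r^{1-ε}(T-t)^{ε/2}|u| ≤ C` on
`(0,T) × ℝ³` for some `ε ∈ [0,1]` and any `C` is bounded on `[0,T) × B_R` for every `R > 0` (indeed on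
`[0,T) × ℝ³`).  `0 < ε ≤ 1`: the envelope gives the one-sided κ-gate (`kappaGate_of_mixedEnvelope`) and the
tree's unconditional κ-inflow criterion `hasSmoothExtensionPast_of_kappaEnvelope_holds` extends the solution
past `T`; `ε = 0`: the axis-bound alternative of `knss_no_axisymmetric_typeI_holds` (at `t = 0` via the rapid
decay of the datum); then `FastClassSqueeze.bounded_of_hasSmoothExtensionPast`.  The printed hypotheses
`‖swirl (u 0)‖_∞ < ∞` and `p ∈ L^{5/3}` are not needed.
[cite: ChenStrainTsaiYau2009, Thm. 1.1 (arXiv:0709.4230 §1, (1.4))] -/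
theorem ChenStrainTsaiYau2009_mixedEnvelope_regular_holds : ChenStrainTsaiYau2009_mixedEnvelope_regular := by
  intro ε C T hε0 hε1 hT u p hcl hLH hdec hax _hswirl _hp henv R _hR
  suffices h : ∃ M : ℝ, ∀ t ∈ Ico 0 T, ∀ x, ‖u t x‖ ≤ M by
    obtain ⟨M, hM⟩ := h
    exact ⟨M, fun t ht x _ => hM t ht x⟩
  have hbd := RadialInflowComparisonT.exists_bound_subslab one_pos hT hcl hLH hdec
  have hext : HasSmoothExtensionPast 1 0 u T := by
    rcases hε0.eq_or_lt with h0 | hpos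
    · -- `ε = 0`: the axis bound `r‖u‖ ≤ C'` on `[0,T)`
      subst h0
      obtain ⟨C₀, hC₀⟩ := hdec 0 1
      refine knss_no_axisymmetric_typeI_holds one_pos hT hcl hLH hbd hax (Or.inr ⟨max C C₀, fun t ht x => ?_⟩)
      rcases ht.1.eq_or_lt with h00 | htpos
      · rw [← h00]
        have h1 := hC₀ x
        rw [pow_one, norm_iteratedFDeriv_zero] at h1
        calc cylRadius x * ‖u 0 x‖ ≤ (1 + ‖x‖) * ‖u 0 x‖ :=
              mul_le_mul_of_nonneg_right ((PeriodicCylinder.cylRadius_le_norm x).trans (by linarith [norm_nonneg x]))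
                (norm_nonneg _)
          _ ≤ C₀ := h1
          _ ≤ max C C₀ := le_max_right _ _
      · exact ((hasMixedEnvelope_zero_iff.1 henv) t ⟨htpos, ht.2⟩ x).trans (le_max_left _ _)
    · -- `0 < ε ≤ 1`: one-sided κ-gate from the envelope + the κ-inflow criterion
      obtain ⟨B, hB⟩ := hbd (T / 2) (by linarith)
      obtain ⟨M, hM, hgate⟩ :=
        kappaGate_of_mixedEnvelope hpos hε1 hT henv (by positivity : 0 < T / 2) hB
      exact hasSmoothExtensionPast_of_kappaEnvelope_holds hpos hε1 hM one_pos hT hcl hLH hdec hax hgate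
  exact FastClassSqueeze.bounded_of_hasSmoothExtensionPast 1 T one_pos hT u p hcl hLH hdec hext

/-- **Corollary: the whole-space bound.**  Under the hypotheses of the named fact the solution is bounded on
all of `[0,T) × ℝ³` (not only on balls), and extends smoothly past `T`. [cite: ChenStrainTsaiYau2009, Thm. 1.1] -/
theorem hasSmoothExtensionPast_of_mixedEnvelope {ε C T : ℝ} (hε0 : 0 < ε) (hε1 : ε ≤ 1) (hT : 0 < T)
    {u : ℝ → EuclideanSpace ℝ (Fin 3) → EuclideanSpace ℝ (Fin 3)} {p : ℝ → EuclideanSpace ℝ (Fin 3) → ℝ}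
    (hcl : IsClassicalNSSolutionOn (Ico 0 T) 1 0 u p) (hLH : IsLerayHopfOn T 1 0 (u 0) u)
    (hdec : HasRapidSpatialDecay (u 0)) (hax : ∀ t ∈ Ico 0 T, IsAxisymmetric (u t))
    (henv : HasMixedEnvelope ε C T u) :
    HasSmoothExtensionPast 1 0 u T := by
  obtain ⟨B, hB⟩ := RadialInflowComparisonT.exists_bound_subslab one_pos hT hcl hLH hdec (T / 2) (by linarith)
  obtain ⟨M, hM, hgate⟩ :=
    kappaGate_of_mixedEnvelope hε0 hε1 hT henv (by positivity : 0 < T / 2) hB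
  exact hasSmoothExtensionPast_of_kappaEnvelope_holds hε0 hε1 hM one_pos hT hcl hLH hdec hax hgate

end Summit.NavierStokesRegularity.NavierStokesRegularity.Theorems

end
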